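import Summits.ResolutionOfSingularities.ResolutionOfSingularities.Theorems.EquisingularLiftEquisingularLiftNatBlowupDisjointTransport
import Summits.ResolutionOfSingularities.ResolutionOfSingularities.Theorems.EquisingularLiftEquisingularLiftNatModelStep
import Literature.AlgebraicGeometry.Resolution.SncSaturatedCentre
import Literature.AlgebraicGeometry.Resolution.ReducedSubschemes
import HarnessLib

/-!
# [OURS · L1 W4.5(b) · EL♮(3)] THE SHADOW THROUGH A ČECH ROUND OFF THE SECTION — bricks for (N3)/(N3′) under (α) `Z ∩ closure K = ∅`:
# the Čech centre misses the shadow, the shadow's strict transform is its total transform, and its special-fibre trace is the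
# reduced `closure υ₂⁻¹(K ∖ Z)`; the old-surface pair `(St_𝒞 𝓔, St_𝒞 𝒦)` has `St 𝓔 ⊔ St 𝒦 = (𝓔 ⊔ 𝒦)·𝒪_{X₂}`

Crux chain w45b (cell `res-hironaka`, slot W4.5(b)), working crux **EL♮** = stmt-ResolutionOfSingularities-20038, child **EL♮(3)** =
stmt-ResolutionOfSingularities-20148, route EquisingularLift, line `sections`; rung TOWER₄, stand-in S6 `hCech` (res-D-pv-057's `Tower.hCech_of₂`)
⇐ (N3) `hShadow` / (N3′) `hShadowOld` (the shadow clauses (k-ii)–(k-vi) after a Čech round). res-L1-w45b-stub-2 FINDING 2026-08-27T21:02:47Z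
((N3) false as typed when the shadow is tangent to the section) + PROPOSAL (α) «Čech rounds keep the shadow only OFF the section:
`Z ∩ closure K = ∅`» — desk view (α) (res-L1-w45b-plan-1 21:09:43Z), text owner's word pending (res-L1-w45b-lead-2 g3). This file = the
centre-agnostic bricks the (α)-discharge of (N3)/(N3′) is assembled from (written ahead of the word; nothing here depends on the menu text).
HONEST FRAMING: OURS; NOT a statement of any manuscript; AI-written, weaker than expert review. No `sorry`; standard axioms. DEF-FREE.
`--supports stmt-ResolutionOfSingularities-20148 --as helper`.

WHAT (namespace `…Cruxes.EquisingularLiftNat.Sections`; `υ : G′ → G` a blow-up along ANY `J`, `τ : X₂ → X` a blow-up along ANY `𝒞`).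
* `closure_preimage_closure_diff_support`, `preimage_closure_eq_of_disjoint_support` — `υ⁻¹(closure K) = closure υ⁻¹(K ∖ supp J)` when
  `closure K ∩ supp J = ∅` (res-L1-w45b-stub-4's point-centre lemmas of …NatBlowupDisjointTransport for an arbitrary closed centre).
* `comap_comap_eq_vanishingIdeal_of_disjoint_closure` — (k-ii) TRANSPORTED: model square `j′ ≫ τ = υ ≫ j`, `I·𝒪_G = 𝓘⟨closure K⟩`,
  `closure K ∩ supp J = ∅` ⇒ `(I·𝒪_{X₂})·𝒪_{G′} = 𝓘⟨closure υ⁻¹(K ∖ supp J)⟩`; `comap_comap_comap_ι_eq_of_disjoint_closure` — its (k-ii-loc)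
  form (res-D-pv-029's `Tower.Shadow₃`): the equality RESTRICTED to `υ⁻¹V` from the equality restricted to `V`.
* `disjoint_support_of_model_traces` — **the Čech centre misses the shadow**: over a universally closed `r : X → Spec O` with model
  square `jG`, if every point of `supp 𝒞` in the special fibre comes from `Z` and no point of `Z` maps into `supp 𝒦`, then
  `supp 𝒦 ∩ supp 𝒞 = ∅` (the closed image of `supp 𝒦 ∩ supp 𝒞` in `Spec O` would contain the closed point).
* `not_mem_support_of_trace_loc` — reading «`jG z ∉ supp 𝒦`» off (k-ii-loc) and `Z ∩ closure K = ∅`, `Z ⊆ V`.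
* `strictTransformIdeal_sup_comap_eq_of_disjoint` — `St_𝒞 𝓔 ⊔ 𝒦·𝒪_{X₂} = (𝓔 ⊔ 𝒦)·𝒪_{X₂}` when `supp 𝒦 ∩ supp 𝒞 = ∅` (stalkwise: off the
  centre `St 𝓔 = 𝓔·𝒪`, over the centre both sides are the unit ideal), and `comap_sup_comap_eq_top_of_disjoint` —
  `𝒞·𝒪_{X₂} ⊔ 𝒦·𝒪_{X₂} = ⊤` (the new exceptional divisor misses the transported shadow).

References (index only): Görtz–Wedhorn I Prop. 13.91 (3), (13.19); Stacks 02OS, 033B, 01K0 — all through the tree (Literature `BlowupOffCentre`,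
`StrictTransformClosedSetPieces`; …NatBlowupDisjointTransport (res-L1-w45b-stub-4), …NatModelStep (res-D-pv-029)).
[cite: GortzWedhorn2020, Prop. 13.91] [cite: StacksProject, Tag 02OS]
-/

set_option linter.dupNamespace false -- mandated namespace `Summit.<Summit>.<Problem>` of this single-conjunct summit

noncomputable section

open CategoryTheory CategoryTheory.Limits AlgebraicGeometry TopologicalSpace Topology IsLocalRing
open Literature.AlgebraicGeometry.Resolution
open AlgebraicGeometry.Scheme.IdealSheafData

namespace Summit.ResolutionOfSingularities.ResolutionOfSingularities.Cruxes.EquisingularLiftNat.Sections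

/-! ## 1. Downstairs: the topological shadow through a blow-up along a closed centre disjoint from it -/

section Downstairs

variable {G G' : Scheme.{0}} {υ : G' ⟶ G} {J : G.IdealSheafData}

/-- For a blow-up `υ` along ANY centre and any `K ⊆ G`: `closure υ⁻¹(closure K ∖ supp J) = closure υ⁻¹(K ∖ supp J)` (over `G ∖ supp J`
the blow-up is an open immersion). [cite: GortzWedhorn2020, Prop. 13.91 (3) p. 414] -/
theorem closure_preimage_closure_diff_support (hυ : IsBlowup υ J) (K : Set G) :
    closure (υ ⁻¹' (closure K \ (J.support : Set G))) = closure (υ ⁻¹' (K \ (J.support : Set G))) := by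
  have hZc : IsClosed (J.support : Set G) := J.support.isClosed
  refine Set.Subset.antisymm (closure_minimal ?_ isClosed_closure)
    (closure_mono (Set.preimage_mono fun z hz => ⟨subset_closure hz.1, hz.2⟩))
  rintro x' ⟨hxK, hxy⟩
  have h1 : υ x' ∈ closure (K \ (J.support : Set G)) := by
    have h2 : closure K \ (J.support : Set G) ⊆ closure (K \ (J.support : Set G)) := by
      rw [Set.sdiff_eq, Set.sdiff_eq]
      exact hZc.isOpen_compl.closure_inter
    exact h2 ⟨hxK, hxy⟩
  exact hυ.preimage_closure_diff_support_subset (K \ (J.support : Set G)) ⟨h1, hxy⟩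

/-- For a blow-up `υ` along a centre DISJOINT from the closed set `closure K`: `υ⁻¹(closure K) = closure υ⁻¹(K ∖ supp J)` (and
`K ∖ supp J = K`). [cite: GortzWedhorn2020, Prop. 13.91 (3) p. 414] -/
theorem preimage_closure_eq_of_disjoint_support (hυ : IsBlowup υ J) (K : Set G)
    (hK : Disjoint (closure K) (J.support : Set G)) :
    υ ⁻¹' closure K = closure (υ ⁻¹' (K \ (J.support : Set G))) := by
  rw [← closure_preimage_closure_diff_support hυ K, hK.sdiff_eq_left]
  exact ((isClosed_closure.preimage υ.continuous).closure_eq).symm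

end Downstairs

/-! ## 2. The trace of the transported shadow (exact and localized forms) -/

section Trace

variable {X X₂ G G' : Scheme.{0}} {τ : X₂ ⟶ X} {jG : G ⟶ X} {j₂ : G' ⟶ X₂} {υ : G' ⟶ G} {J : G.IdealSheafData}

/-- **(k-ii) through the round**: in a model square `j₂ ≫ τ = υ ≫ jG` with `υ` a blow-up along `J`, an ideal sheaf `𝒦` with reduced trace
`𝒦·𝒪_G = 𝓘⟨closure K⟩` and `closure K ∩ supp J = ∅`: `(𝒦·𝒪_{X₂})·𝒪_{G′} = 𝓘⟨closure υ⁻¹(K ∖ supp J)⟩`. [cite: StacksProject, Tag 033B]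
[cite: GortzWedhorn2020, (13.19) p. 414] -/
theorem comap_comap_eq_vanishingIdeal_of_disjoint_closure [IsLocallyNoetherian G] (hcomm : j₂ ≫ τ = υ ≫ jG)
    (hυ : IsBlowup υ J) (𝒦 : X.IdealSheafData) (K : Set G)
    (hk : 𝒦.comap jG = vanishingIdeal ⟨closure K, isClosed_closure⟩) (hK : Disjoint (closure K) (J.support : Set G)) :
    (𝒦.comap τ).comap j₂ = vanishingIdeal ⟨closure (υ ⁻¹' (K \ (J.support : Set G))), isClosed_closure⟩ := by
  rw [← Scheme.IdealSheafData.comap_comp, hcomm, Scheme.IdealSheafData.comap_comp, hk,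
    hυ.comap_vanishingIdeal_of_disjoint _ hK]
  congr 1
  apply Closeds.ext
  change υ ⁻¹' closure K = closure (υ ⁻¹' (K \ (J.support : Set G)))
  exact preimage_closure_eq_of_disjoint_support hυ K hK

/-- **(k-ii-loc) through the round** (res-D-pv-029's `Tower.Shadow₃`): if the two traces agree on an open `V` of `G`, then the transported ones
agree on `υ⁻¹V`. [cite: StacksProject, Tag 033B] -/
theorem comap_comap_comap_ι_eq_of_disjoint_closure [IsLocallyNoetherian G] (hcomm : j₂ ≫ τ = υ ≫ jG)
    (hυ : IsBlowup υ J) (𝒦 : X.IdealSheafData) (K : Set G) (V : G.Opens)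
    (hk : (𝒦.comap jG).comap V.ι = (vanishingIdeal (⟨closure K, isClosed_closure⟩ : Closeds G)).comap V.ι)
    (hK : Disjoint (closure K) (J.support : Set G)) :
    ((𝒦.comap τ).comap j₂).comap (υ ⁻¹ᵁ V).ι =
      (vanishingIdeal (⟨closure (υ ⁻¹' (K \ (J.support : Set G))), isClosed_closure⟩ : Closeds G')).comap (υ ⁻¹ᵁ V).ι := by
  have h1 : ((𝒦.comap τ).comap j₂).comap (υ ⁻¹ᵁ V).ι = ((𝒦.comap jG).comap V.ι).comap (υ ∣_ V) := by
    rw [← Scheme.IdealSheafData.comap_comp, ← Scheme.IdealSheafData.comap_comp, ← Scheme.IdealSheafData.comap_comp,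
      ← Scheme.IdealSheafData.comap_comp, Category.assoc, hcomm, ← Category.assoc, ← morphismRestrict_ι, Category.assoc]
  have h2 : (vanishingIdeal (⟨closure (υ ⁻¹' (K \ (J.support : Set G))), isClosed_closure⟩ : Closeds G')).comap (υ ⁻¹ᵁ V).ι =
      ((vanishingIdeal (⟨closure K, isClosed_closure⟩ : Closeds G)).comap V.ι).comap (υ ∣_ V) := by
    rw [← Scheme.IdealSheafData.comap_comp, morphismRestrict_ι, Scheme.IdealSheafData.comap_comp,
      hυ.comap_vanishingIdeal_of_disjoint _ hK]
    congr 2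
    apply Closeds.ext
    change closure (υ ⁻¹' (K \ (J.support : Set G))) = υ ⁻¹' closure K
    exact (preimage_closure_eq_of_disjoint_support hυ K hK).symm
  rw [h1, h2, hk]

end Trace

/-! ## 3. The Čech centre misses the shadow -/

section Disjoint

/-- **The centre misses the shadow.** Over `Spec O`, `O` local, with a universally closed structure map `r : X → Spec O` whose special
fibre is the range of `jG : G → X`: if every special point of `supp 𝒞` comes from `Z ⊆ G` and no point of `Z` maps into `supp 𝒦`, then
`supp 𝒦 ∩ supp 𝒞 = ∅`. [cite: StacksProject, Tag 01K0] -/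
theorem disjoint_support_of_model_traces {O : Type} [CommRing O] [IsLocalRing O] {X G : Scheme.{0}} (r : X ⟶ Spec (.of O))
    [UniversallyClosed r] (jG : G ⟶ X) (hfib : ∀ x : X, r x = closedPoint O → x ∈ Set.range jG)
    (𝒞 𝒦 : X.IdealSheafData) (Z : Set G) (hCZ : ∀ g : G, jG g ∈ (𝒞.support : Set X) → g ∈ Z)
    (hKZ : ∀ g ∈ Z, jG g ∉ (𝒦.support : Set X)) :
    Disjoint (𝒦.support : Set X) (𝒞.support : Set X) := by
  rw [Set.disjoint_iff_inter_eq_empty]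
  by_contra hne
  have hcl : IsClosed (r '' ((𝒦.support : Set X) ∩ (𝒞.support : Set X))) :=
    r.isClosedMap _ (𝒦.support.isClosed.inter 𝒞.support.isClosed)
  have hmem : closedPoint O ∈ r '' ((𝒦.support : Set X) ∩ (𝒞.support : Set X)) := by
    by_contra hnot
    have hU : (⟨(r '' ((𝒦.support : Set X) ∩ (𝒞.support : Set X)))ᶜ, hcl.isOpen_compl⟩ : Opens (PrimeSpectrum O)) = ⊤ :=
      (IsLocalRing.closed_point_mem_iff).mp hnot
    have h1 := congrArg (fun U : Opens (PrimeSpectrum O) => ((U : Set (PrimeSpectrum O)))ᶜ) hU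
    simp only [Opens.coe_mk, compl_compl, Opens.coe_top, Set.compl_univ] at h1
    exact hne (Set.image_eq_empty.mp h1)
  obtain ⟨c, ⟨hcK, hcC⟩, hc⟩ := hmem
  obtain ⟨g, rfl⟩ := hfib c hc
  exact hKZ g (hCZ g hcC) hcK

/-- The special fibre of a model square over `θ : O ↠ k` is the range of `jG`. [folklore] -/
theorem mem_range_of_model {O k : Type} [CommRing O] [IsLocalRing O] [Field k] (θ : O →+* k) (hθ : Function.Surjective θ)
    {X G : Scheme.{0}} (r : X ⟶ Spec (.of O)) (jG : G ⟶ X) (tG : G ⟶ Spec (.of k))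
    (hsq : IsPullback jG tG r (Spec.map (CommRingCat.ofHom θ))) (x : X) (hx : r x = closedPoint O) : x ∈ Set.range jG := by
  rw [range_eq_preimage_of_isPullback hsq, range_specMap_of_surjective_of_field θ hθ]
  exact hx

/-- Reading «every special point of `supp 𝒞` comes from `Z`» off the exact trace `𝒞·𝒪_G = 𝓘⟨Z⟩`. [folklore] -/
theorem mem_of_comap_eq_vanishingIdeal {X G : Scheme.{0}} (jG : G ⟶ X) (𝒞 : X.IdealSheafData) {Z : Set G} (hZ : IsClosed Z)
    (hC : 𝒞.comap jG = vanishingIdeal ⟨Z, hZ⟩) (g : G) (hg : jG g ∈ (𝒞.support : Set X)) : g ∈ Z := by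
  have h : g ∈ ((𝒞.comap jG).support : Set G) := by rw [Scheme.IdealSheafData.support_comap]; exact hg
  rw [hC, Scheme.IdealSheafData.coe_support_vanishingIdeal] at h
  exact h

/-- Reading «no point of `Z` maps into `supp 𝒦`» off (k-ii-loc) `(𝒦·𝒪_G)|_V = 𝓘⟨closure K⟩|_V`, `Z ⊆ V`, `Z ∩ closure K = ∅`. [folklore] -/
theorem not_mem_support_of_trace_loc {X G : Scheme.{0}} (jG : G ⟶ X) (𝒦 : X.IdealSheafData) (K : Set G) (V : G.Opens)
    (hk : (𝒦.comap jG).comap V.ι = (vanishingIdeal (⟨closure K, isClosed_closure⟩ : Closeds G)).comap V.ι)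
    {Z : Set G} (hZV : Z ⊆ (V : Set G)) (hZK : Disjoint Z (closure K)) (g : G) (hg : g ∈ Z) :
    jG g ∉ (𝒦.support : Set X) := by
  intro hmem
  have h1 : (⟨g, hZV hg⟩ : V) ∈ ((((𝒦.comap jG).comap V.ι)).support : Set V) := by
    rw [Scheme.IdealSheafData.support_comap, Scheme.IdealSheafData.support_comap]
    exact hmem
  rw [hk, Scheme.IdealSheafData.support_comap, Closeds.coe_preimage, Scheme.IdealSheafData.coe_support_vanishingIdeal] at h1
  exact Set.disjoint_left.mp hZK hg h1

end Disjoint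

/-! ## 4. Upstairs: the old-surface pair off the centre -/

section Upstairs

variable {X X₂ : Scheme.{0}} [IsLocallyNoetherian X] [IsLocallyNoetherian X₂] {τ : X₂ ⟶ X} {𝒞 : X.IdealSheafData}

/-- **`St_𝒞 𝓔 ⊔ 𝒦·𝒪_{X₂} = (𝓔 ⊔ 𝒦)·𝒪_{X₂}`** when `supp 𝒦 ∩ supp 𝒞 = ∅`: off the centre the strict transform is the total transform, over
the centre both sides contain the unit ideal `(𝒦·𝒪_{X₂})_{x}`. [cite: GortzWedhorn2020, (13.19) p. 414] -/
theorem strictTransformIdeal_sup_comap_eq_of_disjoint (hτ : IsBlowup τ 𝒞) (𝓔 𝒦 : X.IdealSheafData)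
    (hK : Disjoint (𝒦.support : Set X) (𝒞.support : Set X)) :
    strictTransformIdeal τ 𝒞 𝓔 ⊔ 𝒦.comap τ = (𝓔 ⊔ 𝒦).comap τ := by
  refine ext_of_forall_stalkIdeal_eq fun x => ?_
  rw [stalkIdeal_sup, Scheme.IdealSheafData.comap_sup, stalkIdeal_sup]
  by_cases hx : τ x ∈ (𝒞.support : Set X)
  · have htop : stalkIdeal (𝒦.comap τ) x = ⊤ := by
      by_contra h
      have hmem : x ∈ ((𝒦.comap τ).support : Set X₂) := (mem_support_iff_stalkIdeal_ne_top _ _).mpr h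
      rw [Scheme.IdealSheafData.support_comap] at hmem
      exact Set.disjoint_left.mp hK hmem hx
    rw [htop, sup_top_eq, sup_top_eq]
  · rw [hτ.stalkIdeal_strictTransformIdeal_of_not_mem 𝓔 hx]

omit [IsLocallyNoetherian X] [IsLocallyNoetherian X₂] in
/-- **The new exceptional divisor misses the transported shadow**: `𝒞·𝒪_{X₂} ⊔ 𝒦·𝒪_{X₂} = ⊤` when `supp 𝒦 ∩ supp 𝒞 = ∅`. [folklore] -/
theorem comap_sup_comap_eq_top_of_disjoint (τ : X₂ ⟶ X) (𝒞 𝒦 : X.IdealSheafData)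
    (hK : Disjoint (𝒦.support : Set X) (𝒞.support : Set X)) : 𝒞.comap τ ⊔ 𝒦.comap τ = ⊤ := by
  refine sup_eq_top_of_disjoint_support ?_
  rw [Scheme.IdealSheafData.support_comap, Scheme.IdealSheafData.support_comap, Closeds.coe_preimage, Closeds.coe_preimage]
  exact hK.symm.preimage τ

end Upstairs

end Summit.ResolutionOfSingularities.ResolutionOfSingularities.Cruxes.EquisingularLiftNat.Sections

end
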